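/-
Copyright (c) 2026 the pub-hodgecm-mathlib formalisation cell (harness21).  Prover seat hodgecm-mathlib-K2E5-p16 (g6), Track B «K2-LIT»,
#184♮ = hLiu418 = `stmt-HodgeConjecture-24832`; row `K2LiuArchIntertwiningLieEquivariance`, file (A) `K2LiuArchIntertwiningLieDerivative`,
PART 1 (pointwise letters): the derivative of the intertwining integrand at a general parameter, its factorisation through the tube point, the
UNIFORM pointwise domination, and the continuity of the integrands.  THEOREMS ONLY (no `def`, no `instance`, no notation, no named-fact
hypothesis, no `sorry`; no matrix norm in any statement).
-/
import Summits.HodgeConjecture.HodgeConjecture.Theorems.K2LiuArchScalarSectionCurveDerivative   -- ★ K2Liu-p11 (g2): the master formula at `t = 0`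
import Summits.HodgeConjecture.HodgeConjecture.Theorems.K2LiuArchIntertwiningMajorant           -- ★ (this seat) (L-ii): continuity ∕ modulus of `f⁰`
import Summits.HodgeConjecture.HodgeConjecture.Theorems.K2LiuHermTwoResolventBounds              -- ★ (this seat) (L-i): entrywise toolkit
import Mathlib.Analysis.Calculus.Deriv.Shift
import HarnessLib

/-!
# Crux `HLiu418`, A∞ organ, (A) part 1: pointwise letters for the swap lemma `d∕dt M_w f⁰_{s,k}(g γ_t) = M_w(∂_t f⁰_{s,k}(· γ_t))(g)`

Cell `hodgecm-mathlib`, crux item hLiu418 = `stmt-HodgeConjecture-24832` (helper lane `--supports`, count-neutral).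

Frame of record (★ (D∞), ★ H1-A∕B): `M_w f (g) = ∫_{r} f (J · n(hermOfReal r) · g)`, `f⁰_{s,k} = archScalarSection k s = j^{−k}‖j‖^{k−2s−l}`,
`j(y) = det Δ_y`, `Δ_y = denom y (i1)`.  For the integrand `F(t, X) = f⁰_{s,k}(J n(X) g γ_t)` one has (★ `denom_J_mul_transl`)
`Δ = num(gγ_t) + X·denom(gγ_t) = (X + Z_t)·d_t` with `d_t = denom (gγ_t) (i1)`, `Z_t = (gγ_t)·i1`, and along the velocity `gγ′_t`
`Δ′ = num(gγ′_t) + X·denom(gγ′_t) = (X + Z_t)·D′_t + K_t`, `K_t = num(gγ′_t) − Z_t·denom(gγ′_t)`.  Hence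
`Δ⁻¹Δ′ = d_t⁻¹·(D′_t + (X + Z_t)⁻¹·K_t)` is bounded UNIFORMLY in the Hermitian integration variable `X` (★ (L-i)
`exists_resolvent_perturb`), and `|F| = |det(X + Z_t)|^{−a}·|det d_t|^{−a}`, `a = 2σ + 2` (★ (L-ii)).
* §1 eventual entrywise bounds from continuity at `0` (`eventually_norm_sub_apply_le`, `eventually_norm_apply_le`, `eventually_half_norm_le`);
* §2 the master formula AT A GENERAL PARAMETER `t` (generic rank): `hasDerivAt_archScalarSection_mul_curve_at` — reparametrise
  `γ̃_u = γ_t⁻¹ γ_{t+u}` in ★ p859383;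
* §3 the factorisations `denom_transl_eq_mul` and `inv_mul_transl_deriv_eq`;
* §4 the UNIFORM POINTWISE DOMINATION `norm_kernel_mul_logDeriv_le` (pure `2 × 2` matrix analysis);
* §5 continuity of `hermOfReal`, of the integrand and of the derivative integrand in the integration variable.
References: [Shimura1982, §1]; [Shimura1997, §16.4]; [Knapp1986, Ch. VI §2] (differentiating intertwining integrals along one-parameter groups).
HONEST LABEL: HC_CM is proved only modulo the 7 printed citations (2 remaining named inputs: hLiu418 = stmt-HodgeConjecture-24832,
h413 = stmt-HodgeConjecture-24833) until rung 0 closes; count-neutral helper, closes no socket.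
-/

set_option autoImplicit false
set_option linter.dupNamespace false

noncomputable section

open Complex Matrix MeasureTheory Filter
open scoped ComplexConjugate ComplexOrder Topology

namespace Summit.HodgeConjecture.HodgeConjecture.Cruxes.HLiu418.K2LiuArchIntertwiningLieDerivativePrelims

open Literature.NumberTheory.ModularForms.SiegelUpperHalfSpace (num denom moeb num_def denom_def moeb_def moeb_mul_denom)
open Summit.HodgeConjecture.HodgeConjecture.Cruxes.HLiu418.K2LiuHermTwoGammaDefs
open Summit.HodgeConjecture.HodgeConjecture.Cruxes.HLiu418.K2LiuArchInducedTubeDefs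
open Summit.HodgeConjecture.HodgeConjecture.Cruxes.HLiu418.K2LiuArchInducedTubeSection (denom_J_mul_transl)
open Summit.HodgeConjecture.HodgeConjecture.Cruxes.HLiu418.K2LiuArchScalarSectionCurveDerivative (hasDerivAt_archScalarSection_mul_curve)
open Summit.HodgeConjecture.HodgeConjecture.Cruxes.HLiu418.K2LiuArchIntertwiningMajorant
open Summit.HodgeConjecture.HodgeConjecture.Cruxes.HLiu418.K2LiuHermTwoResolventBounds

/-! ## §1  Eventual entrywise bounds from continuity at `0` -/

/-- Continuity at `0` of a `2 × 2`-matrix-valued function gives, for every `η > 0`, eventually `‖(M t − M 0)ᵢⱼ‖ ≤ η`. [folklore] -/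
theorem eventually_norm_sub_apply_le {M : ℝ → Matrix (Fin 2) (Fin 2) ℂ} (hM : ContinuousAt M 0) {η : ℝ} (hη : 0 < η) :
    ∀ᶠ t in 𝓝 (0 : ℝ), ∀ i j, ‖(M t - M 0) i j‖ ≤ η := by
  have h : ∀ i j, ∀ᶠ t in 𝓝 (0 : ℝ), ‖(M t - M 0) i j‖ ≤ η := by
    intro i j
    have hc : ContinuousAt (fun t => M t i j) 0 := ((continuous_id.matrix_elem i j).continuousAt).comp hM
    have hev := hc.eventually_mem (Metric.closedBall_mem_nhds (M 0 i j) hη)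
    refine hev.mono fun t ht => ?_
    rw [Metric.mem_closedBall, dist_eq_norm] at ht
    rwa [Matrix.sub_apply]
  exact Filter.eventually_all.2 fun i => Filter.eventually_all.2 fun j => h i j

/-- Continuity at `0` gives an eventual ENTRYWISE BOUND `‖(M t)ᵢⱼ‖ ≤ Σ‖(M 0)ᵢⱼ‖ + 1`. [folklore] -/
theorem eventually_norm_apply_le {M : ℝ → Matrix (Fin 2) (Fin 2) ℂ} (hM : ContinuousAt M 0) :
    ∀ᶠ t in 𝓝 (0 : ℝ), ∀ i j, ‖M t i j‖ ≤ (‖M 0 0 0‖ + ‖M 0 0 1‖ + ‖M 0 1 0‖ + ‖M 0 1 1‖) + 1 := by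
  refine (eventually_norm_sub_apply_le hM one_pos).mono fun t ht i j => ?_
  have h1 := ht i j
  have h2 := norm_apply_le_sum (M 0) i j
  have h3 : ‖M t i j‖ ≤ ‖(M t - M 0) i j‖ + ‖M 0 i j‖ := by
    rw [Matrix.sub_apply]
    exact norm_le_norm_sub_add _ _
  linarith

/-- Continuity at `0` of a scalar function with `f 0 ≠ 0` gives eventually `‖f 0‖∕2 ≤ ‖f t‖`. [folklore] -/
theorem eventually_half_norm_le {f : ℝ → ℂ} (hf : ContinuousAt f 0) (h0 : f 0 ≠ 0) :
    ∀ᶠ t in 𝓝 (0 : ℝ), ‖f 0‖ / 2 ≤ ‖f t‖ := by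
  have hpos : 0 < ‖f 0‖ / 2 := by positivity
  have hev := hf.eventually_mem (Metric.closedBall_mem_nhds (f 0) hpos)
  refine hev.mono fun t ht => ?_
  rw [Metric.mem_closedBall, dist_eq_norm, norm_sub_rev] at ht
  have h := norm_sub_norm_le (f 0) (f t)
  linarith

/-! ## §2  The master formula at a general parameter -/

section GeneralParameter

variable {l : Type*} [Fintype l] [DecidableEq l]

/-- Entries of `t ↦ P · γ (t₀ + t)` are differentiable at `0` with derivative `(P · γ′ t₀)ᵢⱼ`. [folklore] -/
theorem hasDerivAt_const_mul_shift_entry {m : Type*} [Fintype m] (P : Matrix m m ℂ) {γ γ' : ℝ → Matrix m m ℂ} (t₀ : ℝ)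
    (hγ : ∀ t i j, HasDerivAt (fun t => γ t i j) (γ' t i j) t) (i j : m) :
    HasDerivAt (fun u : ℝ => (P * γ (t₀ + u)) i j) ((P * γ' t₀) i j) 0 := by
  have hfun : (fun u : ℝ => (P * γ (t₀ + u)) i j) = fun u => ∑ q, P i q * γ (t₀ + u) q j := by
    funext u
    rw [Matrix.mul_apply]
  rw [hfun, Matrix.mul_apply]
  refine HasDerivAt.fun_sum fun q _ => ?_
  have h0 : HasDerivAt (fun t : ℝ => γ t q j) (γ' t₀ q j) (t₀ + 0) := by
    rw [add_zero]
    exact hγ t₀ q j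
  have hq : HasDerivAt (fun u : ℝ => γ (t₀ + u) q j) (γ' t₀ q j) 0 := h0.comp_const_add t₀ 0
  exact hq.const_mul (P i q)

/-- **THE MASTER FORMULA AT A GENERAL PARAMETER** (generic rank `l`): for an entrywise differentiable matrix curve `γ` with `γ_{t₀}` invertible
and `j(x γ_{t₀}, i1) ≠ 0`,
`d∕dt|_{t₀} f⁰_{s,k}(x γ_t) = f⁰_{s,k}(x γ_{t₀}) · ((m∕2 − k)·τ + (m∕2)·conj τ)`, `τ = tr(Δ_{xγ_{t₀}}⁻¹ · denom (x γ′_{t₀}) (i1))`, `m = k − 2s − l`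
— ★ p859383 `hasDerivAt_archScalarSection_mul_curve` transported to `t₀` along `γ̃_u = γ_{t₀}⁻¹ γ_{t₀+u}`. [Shimura1997, §16.4] -/
theorem hasDerivAt_archScalarSection_mul_curve_at (k : ℤ) (s : ℂ) {x : Matrix (l ⊕ l) (l ⊕ l) ℂ}
    {γ γ' : ℝ → Matrix (l ⊕ l) (l ⊕ l) ℂ} {t₀ : ℝ} (hγ : ∀ t i j, HasDerivAt (fun t => γ t i j) (γ' t i j) t)
    (hγt : IsUnit (γ t₀).det) (hx : (denom (x * γ t₀) (I • (1 : Matrix l l ℂ))).det ≠ 0) :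
    HasDerivAt (fun t : ℝ => archScalarSection k s (x * γ t))
      (archScalarSection k s (x * γ t₀) *
        ((((k : ℂ) - 2 * s - (Fintype.card l : ℂ)) / 2 - k) *
            ((denom (x * γ t₀) (I • (1 : Matrix l l ℂ)))⁻¹ * denom (x * γ' t₀) (I • (1 : Matrix l l ℂ))).trace +
          ((k : ℂ) - 2 * s - (Fintype.card l : ℂ)) / 2 *
            conj ((denom (x * γ t₀) (I • (1 : Matrix l l ℂ)))⁻¹ * denom (x * γ' t₀) (I • (1 : Matrix l l ℂ))).trace)) t₀ := by
  set P : Matrix (l ⊕ l) (l ⊕ l) ℂ := (γ t₀)⁻¹ with hP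
  have hPγ : P * γ t₀ = 1 := Matrix.nonsing_inv_mul _ hγt
  have hγP : γ t₀ * P = 1 := Matrix.mul_nonsing_inv _ hγt
  have hc0 : P * γ (t₀ + 0) = 1 := by rw [add_zero, hPγ]
  have hc : ∀ i j, HasDerivAt (fun u : ℝ => (P * γ (t₀ + u)) i j) ((P * γ' t₀) i j) 0 :=
    hasDerivAt_const_mul_shift_entry P t₀ hγ
  have h := hasDerivAt_archScalarSection_mul_curve k s (g := x * γ t₀) (W := P * γ' t₀) hx (γ := fun u => P * γ (t₀ + u)) hc0 hc
  -- identify the curve and the velocity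
  have hcurve : ∀ u : ℝ, x * γ t₀ * (P * γ (t₀ + u)) = x * γ (t₀ + u) := by
    intro u
    rw [Matrix.mul_assoc, ← Matrix.mul_assoc (γ t₀), hγP, Matrix.one_mul]
  have hvel : x * γ t₀ * (P * γ' t₀) = x * γ' t₀ := by
    rw [Matrix.mul_assoc, ← Matrix.mul_assoc (γ t₀), hγP, Matrix.one_mul]
  simp only [hcurve, hvel] at h
  -- shift the parameter back to `t₀`
  have h2 := HasDerivAt.comp_sub_const t₀ t₀ (f := fun u : ℝ => archScalarSection k s (x * γ (t₀ + u))) (by rw [sub_self]; exact h)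
  refine h2.congr_of_eventuallyEq (Eventually.of_forall fun t => ?_)
  simp only [add_sub_cancel]

end GeneralParameter

/-! ## §3  Factorisations through the tube point -/

/-- **`Δ = (X + Z)·d`**: for `d = denom h (i1)` invertible and `Z = h·i1`, `denom (J · n(X) · h) (i1) = (X + Z) · d`. [Shimura1997, §5.2] -/
theorem denom_transl_eq_mul (X : Matrix (Fin 2) (Fin 2) ℂ) {h : Matrix (Fin 2 ⊕ Fin 2) (Fin 2 ⊕ Fin 2) ℂ}
    (hd : IsUnit (denom h (I • (1 : Matrix (Fin 2) (Fin 2) ℂ))).det) :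
    denom (Matrix.J (Fin 2) ℂ * fromBlocks 1 X 0 1 * h) (I • (1 : Matrix (Fin 2) (Fin 2) ℂ)) =
      (X + moeb h (I • (1 : Matrix (Fin 2) (Fin 2) ℂ))) * denom h (I • (1 : Matrix (Fin 2) (Fin 2) ℂ)) := by
  rw [denom_J_mul_transl, Matrix.add_mul, moeb_mul_denom hd, add_comm]

/-- **`Δ⁻¹Δ′ = d⁻¹·(D′ + (X + Z)⁻¹·(A′ − Z·D′))`** for `Δ = (X + Z)·d`, `Δ′ = A′ + X·D′`, `X + Z` and `d` invertible. [folklore] -/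
theorem inv_mul_transl_deriv_eq {X Z A' D' : Matrix (Fin 2) (Fin 2) ℂ} (d : Matrix (Fin 2) (Fin 2) ℂ) (hXZ : IsUnit (X + Z).det) :
    ((X + Z) * d)⁻¹ * (A' + X * D') = d⁻¹ * (D' + (X + Z)⁻¹ * (A' - Z * D')) := by
  have hsplit : A' + X * D' = (X + Z) * D' + (A' - Z * D') := by
    rw [Matrix.add_mul]
    abel
  rw [Matrix.mul_inv_rev, hsplit, Matrix.mul_assoc, Matrix.mul_add (X + Z)⁻¹, Matrix.nonsing_inv_mul_cancel_left _ _ hXZ]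

/-! ## §4  The uniform pointwise domination -/

/-- The modulus of `(m∕2 − k)·τ + (m∕2)·conj τ` is at most `(‖m∕2 − k‖ + ‖m∕2‖)·‖τ‖`. [folklore] -/
theorem norm_affine_conj_le (c₁ c₂ τ : ℂ) : ‖c₁ * τ + c₂ * conj τ‖ ≤ (‖c₁‖ + ‖c₂‖) * ‖τ‖ := by
  calc ‖c₁ * τ + c₂ * conj τ‖ ≤ ‖c₁ * τ‖ + ‖c₂ * conj τ‖ := norm_add_le _ _
    _ = (‖c₁‖ + ‖c₂‖) * ‖τ‖ := by rw [norm_mul, norm_mul, Complex.norm_conj]; ring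

/-- **THE LOGARITHMIC DERIVATIVE IS UNIFORMLY BOUNDED**: with entrywise bounds `‖(X+Z)⁻¹‖ ≤ C`, `‖d⁻¹‖ ≤ βd`, `‖D′‖ ≤ βD`, `‖A′ − Z D′‖ ≤ βK`,
`‖tr(((X + Z)d)⁻¹ (A′ + X D′))‖ ≤ 2·(2 βd (βD + 2 C βK))` — no dependence on `X`. [folklore] -/
theorem norm_trace_logDeriv_le {X Z d A' D' : Matrix (Fin 2) (Fin 2) ℂ} (hXZ : IsUnit (X + Z).det)
    {C βd βD βK : ℝ} (hR : ∀ i j, ‖(X + Z)⁻¹ i j‖ ≤ C) (hdinv : ∀ i j, ‖d⁻¹ i j‖ ≤ βd) (hD' : ∀ i j, ‖D' i j‖ ≤ βD)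
    (hK : ∀ i j, ‖(A' - Z * D') i j‖ ≤ βK) :
    ‖(((X + Z) * d)⁻¹ * (A' + X * D')).trace‖ ≤ 2 * (2 * βd * (βD + 2 * C * βK)) := by
  rw [inv_mul_transl_deriv_eq d hXZ]
  exact norm_trace_le (norm_mul_apply_le hdinv (norm_add_apply_le hD' (norm_mul_apply_le hR hK)))

/-- **THE KERNEL IS UNIFORMLY DOMINATED**: for `Δ = (X + Z)·d` with `‖det(X + Z₀)‖ ≤ 4‖det(X + Z)‖`, `0 < ‖det(X + Z₀)‖`, `δ₀ ≤ ‖det d‖`, `0 < δ₀`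
and `a = 2·re s + 2 ≥ 0`: `‖det Δ^{−k} · ‖det Δ‖^{k−2s−2}‖ ≤ 4^a · δ₀^{−a} · ‖det(X + Z₀)‖^{−a}`. [Shimura1982, (1.26)] -/
theorem norm_kernel_le {X Z Z₀ d : Matrix (Fin 2) (Fin 2) ℂ} (k : ℤ) (s : ℂ) (ha : 0 ≤ 2 * s.re + 2) {δ₀ : ℝ} (hδ₀ : 0 < δ₀)
    (hdet4 : ‖(X + Z₀).det‖ ≤ 4 * ‖(X + Z).det‖) (hdet₀ : 0 < ‖(X + Z₀).det‖) (hd : δ₀ ≤ ‖d.det‖) :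
    ‖((X + Z) * d).det ^ (-k) * ((((‖((X + Z) * d).det‖ : ℝ) : ℂ)) ^ ((k : ℂ) - 2 * s - 2))‖ ≤
      (4 : ℝ) ^ (2 * s.re + 2) * δ₀ ^ (-(2 * s.re + 2)) * ‖(X + Z₀).det‖ ^ (-(2 * s.re + 2)) := by
  have hXZ : 0 < ‖(X + Z).det‖ := by linarith
  have hdpos : 0 < ‖d.det‖ := hδ₀.trans_le hd
  have hΔ0 : ((X + Z) * d).det ≠ 0 := by
    rw [det_mul]
    exact mul_ne_zero (norm_pos_iff.mp hXZ) (norm_pos_iff.mp hdpos)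
  rw [norm_zpow_mul_norm_cpow k _ hΔ0]
  have hexp : (((k : ℂ) - 2 * s - 2).re - k : ℝ) = -(2 * s.re + 2) := by
    simp only [Complex.sub_re, Complex.intCast_re, Complex.mul_re, Complex.re_ofNat, Complex.im_ofNat, zero_mul, sub_zero]
    ring
  rw [hexp, det_mul, norm_mul]
  -- `x₀ = ‖det(X+Z₀)‖·δ₀ ≤ 4·(‖det(X+Z)‖·‖det d‖)`
  have hx₀ : 0 < ‖(X + Z₀).det‖ * δ₀ := mul_pos hdet₀ hδ₀
  have h4 : ‖(X + Z₀).det‖ * δ₀ ≤ 4 * (‖(X + Z).det‖ * ‖d.det‖) := by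
    calc ‖(X + Z₀).det‖ * δ₀ ≤ (4 * ‖(X + Z).det‖) * ‖d.det‖ := mul_le_mul hdet4 hd hδ₀.le (by positivity)
      _ = 4 * (‖(X + Z).det‖ * ‖d.det‖) := by ring
  have h := rpow_neg_le_of_le_four_mul hx₀ h4 ha
  rw [Real.mul_rpow hdet₀.le hδ₀.le] at h
  calc (‖(X + Z).det‖ * ‖d.det‖) ^ (-(2 * s.re + 2))
      ≤ (4 : ℝ) ^ (2 * s.re + 2) * (‖(X + Z₀).det‖ ^ (-(2 * s.re + 2)) * δ₀ ^ (-(2 * s.re + 2))) := h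
    _ = (4 : ℝ) ^ (2 * s.re + 2) * δ₀ ^ (-(2 * s.re + 2)) * ‖(X + Z₀).det‖ ^ (-(2 * s.re + 2)) := by ring

/-- **UNIFORM POINTWISE DOMINATION OF THE DERIVATIVE INTEGRAND** (all hypotheses ENTRYWISE; `a = 2·re s + 2`):
`‖det Δ^{−k}‖det Δ‖^{k−2s−2} · (c₁ τ + c₂ conj τ)‖ ≤ 4^a δ₀^{−a} ‖det(X + Z₀)‖^{−a} · (‖c₁‖ + ‖c₂‖) · 2(2βd(βD + 2CβK))` with `Δ = (X + Z)d`,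
`τ = tr(Δ⁻¹(A′ + X D′))`. [Shimura1982, (1.26); Knapp1986, Ch. VI §2] -/
theorem norm_kernel_mul_logDeriv_le {X Z Z₀ d A' D' : Matrix (Fin 2) (Fin 2) ℂ} (k : ℤ) (s : ℂ) (c₁ c₂ : ℂ) (ha : 0 ≤ 2 * s.re + 2)
    {δ₀ C βd βD βK : ℝ} (hδ₀ : 0 < δ₀) (hdet4 : ‖(X + Z₀).det‖ ≤ 4 * ‖(X + Z).det‖) (hdet₀ : 0 < ‖(X + Z₀).det‖)
    (hd : δ₀ ≤ ‖d.det‖) (hR : ∀ i j, ‖(X + Z)⁻¹ i j‖ ≤ C) (hdinv : ∀ i j, ‖d⁻¹ i j‖ ≤ βd) (hD' : ∀ i j, ‖D' i j‖ ≤ βD)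
    (hK : ∀ i j, ‖(A' - Z * D') i j‖ ≤ βK) :
    ‖((X + Z) * d).det ^ (-k) * ((((‖((X + Z) * d).det‖ : ℝ) : ℂ)) ^ ((k : ℂ) - 2 * s - 2)) *
        (c₁ * (((X + Z) * d)⁻¹ * (A' + X * D')).trace + c₂ * conj (((X + Z) * d)⁻¹ * (A' + X * D')).trace)‖ ≤
      (4 : ℝ) ^ (2 * s.re + 2) * δ₀ ^ (-(2 * s.re + 2)) * ‖(X + Z₀).det‖ ^ (-(2 * s.re + 2)) *
        ((‖c₁‖ + ‖c₂‖) * (2 * (2 * βd * (βD + 2 * C * βK)))) := by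
  have hXZ : IsUnit (X + Z).det := isUnit_iff_ne_zero.mpr (norm_pos_iff.mp (by linarith))
  rw [norm_mul]
  refine mul_le_mul (norm_kernel_le k s ha hδ₀ hdet4 hdet₀ hd) ?_ (norm_nonneg _) (by positivity)
  exact (norm_affine_conj_le c₁ c₂ _).trans
    (mul_le_mul_of_nonneg_left (norm_trace_logDeriv_le hXZ hR hdinv hD' hK) (by positivity))

/-! ## §5  Continuity of the integrands in the integration variable -/

/-- The chart `hermOfReal` is continuous. [folklore] -/
theorem continuous_hermOfReal : Continuous (hermOfReal (l := Fin 2)) := by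
  refine continuous_matrix fun i j => ?_
  simp only [hermOfReal_apply]
  have hij : Continuous fun r : Fin 2 → Fin 2 → ℝ => r i j := (continuous_apply j).comp (continuous_apply i)
  have hji : Continuous fun r : Fin 2 → Fin 2 → ℝ => r j i := (continuous_apply i).comp (continuous_apply j)
  exact (Complex.continuous_ofReal.comp (hij.add hji)).add ((Complex.continuous_ofReal.comp (hij.sub hji)).mul continuous_const)

/-- `r ↦ J · n(hermOfReal r) · h` is continuous. [folklore] -/
theorem continuous_transl_mul (h : Matrix (Fin 2 ⊕ Fin 2) (Fin 2 ⊕ Fin 2) ℂ) :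
    Continuous fun r : Fin 2 → Fin 2 → ℝ => Matrix.J (Fin 2) ℂ * fromBlocks 1 (hermOfReal r) 0 1 * h :=
  ((continuous_const.matrix_mul
    (Continuous.matrix_fromBlocks continuous_const continuous_hermOfReal continuous_const continuous_const)).matrix_mul
      continuous_const)

/-- `hermOfReal r` is Hermitian (as `IsHermitian`). [folklore] -/
theorem isHermitian_hermOfReal (r : Fin 2 → Fin 2 → ℝ) : (hermOfReal r).IsHermitian := conjTranspose_hermOfReal r

/-- On the good set, `j(J n(X) h, i1) ≠ 0` for every Hermitian `X`. [Shimura1997, §6.3] -/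
theorem det_denom_transl_ne_zero {h : Matrix (Fin 2 ⊕ Fin 2) (Fin 2 ⊕ Fin 2) ℂ} (hd : IsUnit (denom h (I • (1 : Matrix (Fin 2) (Fin 2) ℂ))).det)
    (hZ : ∀ X : Matrix (Fin 2) (Fin 2) ℂ, X.IsHermitian → (X + moeb h (I • (1 : Matrix (Fin 2) (Fin 2) ℂ))).det ≠ 0)
    {X : Matrix (Fin 2) (Fin 2) ℂ} (hX : X.IsHermitian) :
    (denom (Matrix.J (Fin 2) ℂ * fromBlocks 1 X 0 1 * h) (I • (1 : Matrix (Fin 2) (Fin 2) ℂ))).det ≠ 0 := by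
  rw [denom_transl_eq_mul X hd, det_mul]
  exact mul_ne_zero (hZ X hX) hd.ne_zero

/-- **The integrand `r ↦ f⁰_{s,k}(J n(hermOfReal r) h)` is continuous** whenever `d = denom h (i1)` is invertible and `det(X + h·i1) ≠ 0` for all
Hermitian `X` (e.g. `h ∈ U(J)`, or `h` near `U(J)`). [Shimura1997, §16.4] -/
theorem continuous_integrand (k : ℤ) (s : ℂ) {h : Matrix (Fin 2 ⊕ Fin 2) (Fin 2 ⊕ Fin 2) ℂ}
    (hd : IsUnit (denom h (I • (1 : Matrix (Fin 2) (Fin 2) ℂ))).det)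
    (hZ : ∀ X : Matrix (Fin 2) (Fin 2) ℂ, X.IsHermitian → (X + moeb h (I • (1 : Matrix (Fin 2) (Fin 2) ℂ))).det ≠ 0) :
    Continuous fun r : Fin 2 → Fin 2 → ℝ => archScalarSection k s (Matrix.J (Fin 2) ℂ * fromBlocks 1 (hermOfReal r) 0 1 * h) :=
  continuous_archScalarSection_comp k s (continuous_transl_mul h) fun r => det_denom_transl_ne_zero hd hZ (isHermitian_hermOfReal r)

/-- `r ↦ (denom (J n(hermOfReal r) h) (i1))⁻¹` is continuous under the same hypotheses. [folklore] -/
theorem continuous_inv_denom_transl {h : Matrix (Fin 2 ⊕ Fin 2) (Fin 2 ⊕ Fin 2) ℂ}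
    (hd : IsUnit (denom h (I • (1 : Matrix (Fin 2) (Fin 2) ℂ))).det)
    (hZ : ∀ X : Matrix (Fin 2) (Fin 2) ℂ, X.IsHermitian → (X + moeb h (I • (1 : Matrix (Fin 2) (Fin 2) ℂ))).det ≠ 0) :
    Continuous fun r : Fin 2 → Fin 2 → ℝ =>
      (denom (Matrix.J (Fin 2) ℂ * fromBlocks 1 (hermOfReal r) 0 1 * h) (I • (1 : Matrix (Fin 2) (Fin 2) ℂ)))⁻¹ := by
  have hc : Continuous fun r : Fin 2 → Fin 2 → ℝ =>
      denom (Matrix.J (Fin 2) ℂ * fromBlocks 1 (hermOfReal r) 0 1 * h) (I • (1 : Matrix (Fin 2) (Fin 2) ℂ)) :=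
    (continuous_denom _).comp (continuous_transl_mul h)
  refine continuous_iff_continuousAt.2 fun r => ?_
  have hne := det_denom_transl_ne_zero hd hZ (isHermitian_hermOfReal r)
  have hinv : ContinuousAt Ring.inverse
      (denom (Matrix.J (Fin 2) ℂ * fromBlocks 1 (hermOfReal r) 0 1 * h) (I • (1 : Matrix (Fin 2) (Fin 2) ℂ))).det := by
    rw [Ring.inverse_eq_inv']
    exact continuousAt_inv₀ hne
  have hA := continuousAt_matrix_inv
    (denom (Matrix.J (Fin 2) ℂ * fromBlocks 1 (hermOfReal r) 0 1 * h) (I • (1 : Matrix (Fin 2) (Fin 2) ℂ))) hinv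
  exact ContinuousAt.comp (g := Inv.inv) hA hc.continuousAt

/-- **The derivative integrand `r ↦ f⁰_{s,k}(J n(X) h) · (c₁ τ + c₂ conj τ)`, `τ = tr(Δ⁻¹ · denom (J n(X) h′) (i1))`, is continuous** under the
same hypotheses. [Shimura1997, §16.4] -/
theorem continuous_deriv_integrand (k : ℤ) (s : ℂ) (c₁ c₂ : ℂ) {h : Matrix (Fin 2 ⊕ Fin 2) (Fin 2 ⊕ Fin 2) ℂ}
    (h' : Matrix (Fin 2 ⊕ Fin 2) (Fin 2 ⊕ Fin 2) ℂ) (hd : IsUnit (denom h (I • (1 : Matrix (Fin 2) (Fin 2) ℂ))).det)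
    (hZ : ∀ X : Matrix (Fin 2) (Fin 2) ℂ, X.IsHermitian → (X + moeb h (I • (1 : Matrix (Fin 2) (Fin 2) ℂ))).det ≠ 0) :
    Continuous fun r : Fin 2 → Fin 2 → ℝ =>
      archScalarSection k s (Matrix.J (Fin 2) ℂ * fromBlocks 1 (hermOfReal r) 0 1 * h) *
        (c₁ * ((denom (Matrix.J (Fin 2) ℂ * fromBlocks 1 (hermOfReal r) 0 1 * h) (I • (1 : Matrix (Fin 2) (Fin 2) ℂ)))⁻¹ *
                  denom (Matrix.J (Fin 2) ℂ * fromBlocks 1 (hermOfReal r) 0 1 * h') (I • (1 : Matrix (Fin 2) (Fin 2) ℂ))).trace +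
          c₂ * conj ((denom (Matrix.J (Fin 2) ℂ * fromBlocks 1 (hermOfReal r) 0 1 * h) (I • (1 : Matrix (Fin 2) (Fin 2) ℂ)))⁻¹ *
                  denom (Matrix.J (Fin 2) ℂ * fromBlocks 1 (hermOfReal r) 0 1 * h') (I • (1 : Matrix (Fin 2) (Fin 2) ℂ))).trace) := by
  have hτ : Continuous fun r : Fin 2 → Fin 2 → ℝ =>
      ((denom (Matrix.J (Fin 2) ℂ * fromBlocks 1 (hermOfReal r) 0 1 * h) (I • (1 : Matrix (Fin 2) (Fin 2) ℂ)))⁻¹ *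
        denom (Matrix.J (Fin 2) ℂ * fromBlocks 1 (hermOfReal r) 0 1 * h') (I • (1 : Matrix (Fin 2) (Fin 2) ℂ))).trace :=
    ((continuous_inv_denom_transl hd hZ).matrix_mul ((continuous_denom _).comp (continuous_transl_mul h'))).matrix_trace
  exact (continuous_integrand k s hd hZ).mul
    ((continuous_const.mul hτ).add (continuous_const.mul (Complex.continuous_conj.comp hτ)))

end Summit.HodgeConjecture.HodgeConjecture.Cruxes.HLiu418.K2LiuArchIntertwiningLieDerivativePrelims

end
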